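import Literature.Computability.AlgebraicComplexity.DepthThreeChasm
import Literature.Computability.AlgebraicComplexity.DepthReductionProofs
import Mathlib.RingTheory.MvPolynomial.Homogeneous
import Mathlib.LinearAlgebra.Vandermonde
import Mathlib.LinearAlgebra.Matrix.NonsingularInverse
import Mathlib.FieldTheory.IsAlgClosed.Basic
import Mathlib.Analysis.Complex.Polynomial.Basic
import Mathlib.Data.Nat.Choose.Sum
import Mathlib.Data.Finsupp.Multiset

/-!
# The chasm at depth three (Gupta–Kamath–Kayal–Saptharishi 2016, Thm. 1.1) — discharge

Sibling proof file of `DepthThreeChasm.lean` (named for the result it discharges, the GKKS form of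
the depth-three chasm). It discharges (D-0014) the named fact
`Literature.Computability.AlgebraicComplexity.gkks_sigmaPiSigma_edgeSize_le_of_complexity`
(GKKS, *Arithmetic circuits: a chasm at depth three*, SIAM J. Comput. 45 (2016) = FOCS 2013 =
ECCC TR13-026, **Thm. 1.1**, first half: an `n`-variate polynomial of degree `d` over `ℂ`
computed by a circuit of size `s` has a `ΣΠΣ` circuit of size — number of WIRES, §3 —
`2^{O(√(d log n log s log d))}`), in the tree's rendering: for every `f : MvPolynomial (Fin n) ℂ`
with `totalDegree f ≤ d` and `complexity f ≤ s` there is an `ArithCircuit` of product-depth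
`≤ 1` computing `f` with at most `2 ^ (K ⌊√(d (log₂ n + 1)(log₂ s + 1)(log₂ d + 1))⌋ + K)`
wires, here with the universal constant `K = 200` (the fact lets `K` depend on the exponent `a`
of the hypothesis `d ≤ n^a + a`; that hypothesis is not needed for the bound carrying the
`log d` factor): `gkks_sigmaPiSigma_edgeSize_le_of_complexity_holds`, from
`DepthThreeChasm.sigmaPiSigma_edgeSize_le`.

## The printed proof and how it is followed (GKKS §2 "Proof Overview", §4)

GKKS prove Thm. 1.1 in three steps, with a cut parameter (`a = d/t` in their notation):

* **Step 1** (§4.1; circuits → ABPs by Lemma 3.1, then Koiran's Thm. 4.1): `f` has a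
  `ΣΠ^{[O(d/t)]}ΣΠ^{[t]}` circuit of top fan-in `s^{O(d/t)}`. HERE this step is the tree's
  already proved algebraic core of the depth-four reduction, `DepthReduction.SLP.exists_sum_prod`
  (`GateQuotients.lean`: Agrawal–Vinay / Tavenas via the VSBR gate quotients): for every `t ≥ 1`,
  `f = Σ_{τ < T₀} ∏_{π < W} p_{τπ}` with `deg p_{τπ} ≤ t`, `T₀ ≤ (d+1)(16 s²(d+1)⁴)^{⌊8d/(t+1)⌋}`,
  `W ≤ 1 + 4⌊8d/(t+1)⌋` (`tzero`, `wmax`). This replaces Lemma 3.1 + Thm. 4.1 and is why the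
  bound carries `log(ds)` per unit of `d/t`, absorbed by the `(log s + 1)(log d + 1)` factor of
  the GKKS form of the statement.
* **Step 2** (§4.2, Fischer's Lemma 4.3 and Lemma 4.4): products become powers of sums. We use
  the Ryser form `w! ∏_{i<w} yᵢ = Σ_{S ⊆ [w]} (-1)^{w-|S|} (Σ_{i∈S} yᵢ)^w`, valid in every
  commutative ring (`fischer_ryser`, by inclusion–exclusion `fischer_ryser_aux`), both for the top
  products
  (`isSPS_prod_lowdeg`) and for each monomial of each `p_{τπ}` (`monomial_fischer`,
  `sparse_fischer`: a polynomial of degree `≤ t` is `Σ_j γ_j ℓ_j^{e_j}` over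
  `j ∈ supp × 2^{[t]}`, `ℓ_j` linear forms with `t` variable slots, `e_j ≤ t`).
* **Step 3** (§4.3, Saxena's duality Lemma 4.6 and Lemma 4.7): `(Σ_{j<m} g_j)^w =
  Σ_{u ≤ (m+1)w} β_u ∏_j E_{w,u}(g_j)` with univariate `E_{w,u}(y) = Σ_{i≤w} uⁱyⁱ/i!`
  (`saxena_duality`: the coefficient of `z^w` in `∏_j E_w(g_j z)` is `(Σ g_j)^w/w!` —
  `coeff_prod_texp` —
  extracted by inverting a Vandermonde matrix at the nodes `0, …, (m+1)w` —
  `coeff_eq_sum_vandermonde_inv`); then `E_{w,u}(γ ℓ^e)` is a univariate of degree `≤ we` in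
  `ℓ`, which splits over `ℂ` into affine linear factors (`IsSPS.aeval`, `isSPS_dualFactor`,
  `isSPS_pow`).

The result of Steps 1–3 is a `ΣΠΣ` EXPRESSION `f = Σ_{i<U} cᵢ ∏_{j<D} φᵢⱼ` (`IsSPS U D t f`,
affine forms `AffForm` with `t` variable wires and one constant wire; closure under padding,
sums, products: `IsSPS.mono/add/smul/sum/mul/prod`), with
`U = T₀ · 2^W ((M+1)W + 1)`, `D = M t W`, `M = (N+1)^t 2^t` (`mmax`; `N` = number of variables,
`(N+1)^t` bounds the sparsity of a degree-`≤ t` polynomial, `card_support_le`) —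
`isSPS_of_lists`. The `ΣΠΣ` builder `slotCircuit` (one weighted-sum gate per affine form, one
product gate per term, one output sum gate; cf. `DepthReduction.sigmaPiCircuit`) computes it
with product-depth `≤ 1` and exactly `U (D (t+2) + 1)` wires (`IsSPS.exists_circuit`; GKKS count
"top fan-in · degree · (n+1)", proof of Lemma 4.7), giving `exists_circuit_generic` with the
explicit bound `bound N s d t`.

## Bookkeeping (GKKS: `a = √(d log s / log n)`)

Write `Ls = log₂ s + 1`, `Ld = log₂ d + 1`, `Ln = log₂ n + 1`, `X = d Ln Ls Ld`, `R = ⌊√X⌋`.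
`exists_circuit_fin` first restricts to the `N ≤ min(n, 2s+2)` variables that occur in a
minimal fan-in-two circuit for `f` (`circVars`, `rename_eq_self`, private copies of
`edgeSize_rename`, `productDepth_rename`; a fan-in-two circuit of size `s` has `≤ 2s` wires). Then
(`sigmaPiSigma_edgeSize_le`): if `Ln ≤ R` take `t = ⌊R/Ln⌋ ≥ 1`, so `t Ln ≤ R` and
`⌊8d/(t+1)⌋ Ls Ld ≤ 8R + 7`, and use `N ≤ n`; if `R < Ln` take `t = 1` and use `N ≤ 2s + 2`
(then `d Ls Ld ≤ R`). In both regimes `bound N s d t ≤ 2^{200 R + 200}` (`bound_le`,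
`tzero_le`, linear arithmetic). Constant `f` (in particular `n = 0`) is a gate-free circuit.

## Relation to `DepthThreeChasmAlgebra.lean` / `DepthThreeChasmCircuits.lean`

Those files (support for the sibling fact `sigmaPiSigma_edgeSize_le_of_complexity`, landed while
this file was written) prove Fischer's identity in the sign-vector form
(`DepthThreeChasm.fischer`), the duality trick as `DepthThreeChasm.duality`, and a `ΣΠΣ`
builder `DepthThreeChasm.spsCircuit` whose affine-form gates have `#σ + 1` wires. The forms
consumed by the pipeline below (Ryser/subset form over a `Finset`; duality with the factors
`dualFactor` and `Fin ((m+1)w+1)` nodes; affine forms with `t` variable SLOTS, so that a form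
gate has `t + 1` wires independently of `#σ`) are proved here as `fischer_ryser`,
`saxena_duality`, `slotCircuit`; the renaming lemmas `edgeSize_rename`, `productDepth_rename`
of `DepthThreeChasmCircuits.lean` are used through private copies (that module was not yet built
on the farm when this file was checked); nothing public is re-declared.

## What is NOT here

The ABP half of Thm. 1.1 and the sharper exponent `√(d log n log s)` of Tavenas 2015, Cor. 1
(the fact `sigmaPiSigma_edgeSize_le_of_complexity` of `DepthThreeChasm.lean`, which needs
Tavenas' parse-tree count in Step 1), the fan-in structure of the intermediate circuits, and the
`ℚ`-coefficient refinement.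

## References

* A. Gupta, P. Kamath, N. Kayal, R. Saptharishi, *Arithmetic circuits: a chasm at depth three*,
  SIAM J. Comput. 45(3) (2016) 1064–1079; FOCS 2013; ECCC TR13-026 (read: pp. 4–11): Thm. 1.1,
  §2, §3 (size = wires), Lemma 4.3 (Fischer 1994), Lemma 4.4, Lemma 4.6 (Saxena 2008),
  Lemma 4.7.
* S. Tavenas, *Improved bounds for reduction to depth 4 and depth 3*, Inform. Comput. 240 (2015),
  Thm. 1 (the depth-four step, here through `GateQuotients.lean` / `DepthReductionProofs.lean`).
* M. Agrawal, V. Vinay, *Arithmetic circuits: a chasm at depth four*, FOCS 2008.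
* P. Bürgisser, *Completeness and Reduction in Algebraic Complexity Theory*, Springer 2000,
  Def. 2.1, Rem. 2.2 (straight-line programs, renaming).
* N. Limaye, S. Srinivasan, S. Tavenas, *Superpolynomial lower bounds against low-depth algebraic
  circuits*, FOCS 2021, §1 (product-depth).
-/

noncomputable section

open Finset

namespace Literature.Computability.AlgebraicComplexity.DepthThreeChasm



/-! ### Fischer's identity (Ryser form), in any commutative ring -/

/-- Inclusion–exclusion behind Fischer's identity: for `N ≤ |s|`,
`Σ_{S ⊆ s} (-1)^{|s|-|S|} (Σ_{i ∈ S} yᵢ)^N` is `|s|! ∏_{i ∈ s} yᵢ` if `N = |s|` and `0` otherwise (any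
commutative ring).
[cite: GuptaKamathKayalSaptharishi2016, Lemma 4.3 (Fischer; Ryser form)] -/
theorem fischer_ryser_aux {A : Type*} [CommRing A] {ι : Type*} [DecidableEq ι] (y : ι → A)
    (s : Finset ι) :
    ∀ N, N ≤ s.card → ∑ S ∈ s.powerset, (-1 : A) ^ (s.card - S.card) * (∑ i ∈ S, y i) ^ N =
      if N = s.card then (s.card.factorial : A) * ∏ i ∈ s, y i else 0 := by
  induction s using Finset.induction_on with
  | empty =>
    intro N hN
    simp only [Finset.card_empty, nonpos_iff_eq_zero] at hN
    subst hN
    simp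
  | @insert a s ha ih =>
    intro N hN
    rw [Finset.card_insert_of_notMem ha] at hN ⊢
    rw [Finset.sum_powerset_insert ha]
    set F : ℕ → A := fun n =>
      ∑ S ∈ s.powerset, (-1 : A) ^ (s.card - S.card) * (∑ i ∈ S, y i) ^ n with hF
    have h1 : ∑ S ∈ s.powerset, (-1 : A) ^ (s.card + 1 - S.card) * (∑ i ∈ S, y i) ^ N =
        -F N := by
      rw [hF]
      simp only
      rw [← Finset.sum_neg_distrib]
      apply Finset.sum_congr rfl
      intro S hS
      have hle : S.card ≤ s.card := Finset.card_le_card (Finset.mem_powerset.1 hS)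
      rw [show s.card + 1 - S.card = (s.card - S.card) + 1 by omega, pow_succ]
      ring
    have h2 : ∀ S ∈ s.powerset, (-1 : A) ^ (s.card + 1 - (insert a S).card) *
        (∑ i ∈ insert a S, y i) ^ N =
        ∑ m ∈ Finset.range (N + 1), ((N.choose m : A) * y a ^ m) *
            ((-1 : A) ^ (s.card - S.card) * (∑ i ∈ S, y i) ^ (N - m)) := by
      intro S hS
      have hSs : S ⊆ s := Finset.mem_powerset.1 hS
      have haS : a ∉ S := fun h => ha (hSs h)
      have hle : S.card ≤ s.card := Finset.card_le_card hSs
      rw [Finset.card_insert_of_notMem haS, Finset.sum_insert haS,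
        show s.card + 1 - (S.card + 1) = s.card - S.card by omega, add_pow, Finset.mul_sum]
      apply Finset.sum_congr rfl
      intro m _
      ring
    rw [h1, Finset.sum_congr rfl h2, Finset.sum_comm]
    have h3 : ∀ m ∈ Finset.range (N + 1),
        ∑ S ∈ s.powerset, ((N.choose m : A) * y a ^ m) *
          ((-1 : A) ^ (s.card - S.card) * (∑ i ∈ S, y i) ^ (N - m)) =
        ((N.choose m : A) * y a ^ m) * F (N - m) := by
      intro m _
      rw [hF, Finset.mul_sum]
    rw [Finset.sum_congr rfl h3, Finset.sum_range_succ']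
    simp only [Nat.choose_zero_right, Nat.cast_one, pow_zero, mul_one, Nat.sub_zero, one_mul]
    rw [show ∀ X : A, -F N + (X + F N) = X from fun X => by ring]
    -- remaining: ∑ m < N, C(N,m+1) ya^(m+1) F (N-(m+1)) = RHS
    have hIH : ∀ m ∈ Finset.range N, ((N.choose (m + 1) : A) * y a ^ (m + 1)) * F (N - (m + 1)) =
        if N - (m + 1) = s.card then
          ((N.choose (m + 1) : A) * y a ^ (m + 1)) * ((s.card.factorial : A) * ∏ i ∈ s, y i)
        else 0 := by
      intro m hm
      simp only [hF]
      rw [ih (N - (m + 1)) (by omega)]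
      split_ifs <;> simp
    rw [Finset.sum_congr rfl hIH]
    by_cases hNs : N = s.card + 1
    · subst hNs
      rw [if_pos rfl, Finset.sum_eq_single 0]
      · simp only [zero_add, Nat.add_sub_cancel, if_true, Nat.choose_one_right, pow_one,
          Finset.prod_insert ha, Nat.factorial_succ, Nat.cast_mul, Nat.cast_add, Nat.cast_one]
        ring
      · intro m hm hm0
        have := Finset.mem_range.1 hm
        rw [if_neg (by omega)]
      · intro h
        simp at h
    · rw [if_neg hNs]
      apply Finset.sum_eq_zero
      intro m hm
      simp only [Finset.mem_range] at hm
      rw [if_neg (by omega)]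

/-- Fischer / Ryser: `|s|! ∏ y = Σ_{S ⊆ s} (-1)^{|s|-|S|} (Σ_S y)^{|s|}`.
[cite: GuptaKamathKayalSaptharishi2016, Lemma 4.3] -/
theorem fischer_ryser {A : Type*} [CommRing A] {ι : Type*} [DecidableEq ι] (y : ι → A)
    (s : Finset ι) :
    (s.card.factorial : A) * ∏ i ∈ s, y i =
      ∑ S ∈ s.powerset, (-1 : A) ^ (s.card - S.card) * (∑ i ∈ S, y i) ^ s.card := by
  rw [fischer_ryser_aux y s s.card le_rfl, if_pos rfl]



/-! ### Saxena's duality trick -/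

section Duality

variable {k : Type*} [Field k] {A : Type*} [CommRing A] [Algebra k A]

open Polynomial in
/-- The truncated exponential `E_w(g Z) = Σ_{i ≤ w} g^i Z^i / i!` as a polynomial in `Z` over `A`.
[cite: GuptaKamathKayalSaptharishi2016, Lemma 4.6 (the truncated exponential `E_d`)] -/
noncomputable def texp (w : ℕ) (g : A) : Polynomial A :=
  ∑ i ∈ Finset.range (w + 1), Polynomial.C (((i.factorial : k)⁻¹) • g ^ i) * Polynomial.X ^ i

omit [Field k] in
/-- Coefficients of the truncated exponential. [folklore] -/
theorem coeff_texp [Field k] [Algebra k A] (w : ℕ) (g : A) (n : ℕ) :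
    (texp (k := k) w g).coeff n = if n ≤ w then ((n.factorial : k)⁻¹) • g ^ n else 0 := by
  unfold texp
  rw [Polynomial.finsetSum_coeff]
  simp only [Polynomial.coeff_C_mul_X_pow]
  split_ifs with h
  · rw [Finset.sum_eq_single n]
    · simp
    · intro i _ hi; rw [if_neg (Ne.symm hi)]
    · intro hn; simp only [Finset.mem_range] at hn; omega
  · apply Finset.sum_eq_zero
    intro i hi
    simp only [Finset.mem_range] at hi
    rw [if_neg (by omega)]

/-- The truncated exponential has degree `≤ w`. [folklore] -/
theorem natDegree_texp_le (w : ℕ) (g : A) : (texp (k := k) w g).natDegree ≤ w := by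
  unfold texp
  apply Polynomial.natDegree_sum_le_of_forall_le
  intro i hi
  simp only [Finset.mem_range] at hi
  exact (Polynomial.natDegree_C_mul_X_pow_le _ _).trans (by omega)

variable [CharZero k]

/-- Low coefficients of `E_w(gZ) E_w(hZ)` and `E_w((g+h)Z)` agree.
[cite: GuptaKamathKayalSaptharishi2016, proof of Lemma 4.6 (`e^{ℓz} = ∏ e^{uᵢz}`, truncated)] -/
theorem coeff_texp_mul_texp (w : ℕ) (g h : A) {n : ℕ} (hn : n ≤ w) :
    (texp (k := k) w g * texp (k := k) w h).coeff n = (texp (k := k) w (g + h)).coeff n := by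
  rw [Polynomial.coeff_mul, coeff_texp, if_pos hn,
    Finset.Nat.sum_antidiagonal_eq_sum_range_succ_mk, add_pow, Finset.smul_sum]
  apply Finset.sum_congr rfl
  intro m hm
  simp only [Finset.mem_range] at hm
  rw [coeff_texp, coeff_texp, if_pos (by omega), if_pos (by omega)]
  have hchoose : (n.choose m : k) * (m.factorial : k) * ((n - m).factorial : k) = n.factorial := by
    exact_mod_cast Nat.choose_mul_factorial_mul_factorial (by omega : m ≤ n)
  have hm0 : (m.factorial : k) ≠ 0 := by exact_mod_cast Nat.factorial_ne_zero m
  have hnm0 : ((n - m).factorial : k) ≠ 0 := by exact_mod_cast Nat.factorial_ne_zero (n - m)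
  have hn0 : (n.factorial : k) ≠ 0 := by exact_mod_cast Nat.factorial_ne_zero n
  rw [show (g ^ m * h ^ (n - m) * (n.choose m : A)) = (n.choose m : k) • (g ^ m * h ^ (n - m)) by
    rw [Algebra.smul_def, map_natCast]; ring]
  rw [smul_mul_smul_comm, smul_smul]
  congr 1
  field_simp
  have := Nat.choose_mul_factorial_mul_factorial (by omega : m ≤ n)
  push_cast [← this]
  ring

omit [CharZero k] in
/-- Truncation is compatible with multiplication. [folklore] -/
theorem coeff_mul_congr_of_le {w : ℕ} {P P' : Polynomial A}
    (hP : ∀ n ≤ w, P.coeff n = P'.coeff n) (Q : Polynomial A) {n : ℕ} (hn : n ≤ w) :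
    (P * Q).coeff n = (P' * Q).coeff n := by
  rw [Polynomial.coeff_mul, Polynomial.coeff_mul]
  apply Finset.sum_congr rfl
  intro x hx
  have := Finset.HasAntidiagonal.antidiagonal.fst_le hx
  rw [hP x.1 (this.trans hn)]

/-- `∏_j E_w(g_j Z) ≡ E_w((Σ_j g_j) Z)` modulo `Z^{w+1}`.
[cite: GuptaKamathKayalSaptharishi2016, proof of Lemma 4.6] -/
theorem coeff_prod_texp {ι : Type*} [DecidableEq ι] (w : ℕ) (g : ι → A) (s : Finset ι) :
    ∀ n ≤ w, (∏ j ∈ s, texp (k := k) w (g j)).coeff n =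
      (texp (k := k) w (∑ j ∈ s, g j)).coeff n := by
  induction s using Finset.induction_on with
  | empty =>
    intro n hn
    rw [Finset.prod_empty, Finset.sum_empty, coeff_texp, Polynomial.coeff_one]
    by_cases h0 : n = 0
    · subst h0; simp
    · rw [if_neg h0, if_pos hn, zero_pow h0, smul_zero]
  | @insert a s ha ih =>
    intro n hn
    rw [Finset.prod_insert ha, Finset.sum_insert ha, mul_comm,
      coeff_mul_congr_of_le ih _ hn, mul_comm, coeff_texp_mul_texp w _ _ hn]

omit [CharZero k] in
/-- Coefficient extraction by interpolation at `N + 1` distinct scalar nodes (inverse Vandermonde).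
[cite: GuptaKamathKayalSaptharishi2016, proof of Lemma 4.6 (interpolation at `md + 1` points)] -/
theorem coeff_eq_sum_vandermonde_inv {N : ℕ} (P : Polynomial A) (hP : P.natDegree ≤ N)
    (α : Fin (N + 1) → k) (hα : Function.Injective α) (l : Fin (N + 1)) :
    P.coeff l = ∑ u, ((Matrix.vandermonde α)⁻¹ l u) • P.eval (algebraMap k A (α u)) := by
  have hdet : IsUnit (Matrix.vandermonde α).det :=
    isUnit_iff_ne_zero.2 ((Matrix.det_vandermonde_ne_zero_iff).2 hα)
  have hBV := Matrix.nonsing_inv_mul (Matrix.vandermonde α) hdet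
  have heval : ∀ u, P.eval (algebraMap k A (α u)) =
      ∑ i : Fin (N + 1), P.coeff i * algebraMap k A (α u ^ (i : ℕ)) := by
    intro u
    rw [Polynomial.eval_eq_sum_range' (Nat.lt_succ_of_le hP), Fin.sum_univ_eq_sum_range
      (fun i => P.coeff i * algebraMap k A (α u ^ i)) (N + 1)]
    simp only [map_pow]
  simp_rw [heval, Finset.smul_sum]
  rw [Finset.sum_comm]
  have hinner : ∀ i : Fin (N + 1),
      ∑ u, ((Matrix.vandermonde α)⁻¹ l u) • (P.coeff i * algebraMap k A (α u ^ (i : ℕ))) =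
      P.coeff i * algebraMap k A (((Matrix.vandermonde α)⁻¹ * Matrix.vandermonde α) l i) := by
    intro i
    rw [Matrix.mul_apply, map_sum, Finset.mul_sum]
    apply Finset.sum_congr rfl
    intro u _
    rw [Matrix.vandermonde_apply, map_mul, Algebra.smul_def]
    ring
  simp_rw [hinner, hBV]
  rw [Finset.sum_eq_single l]
  · simp
  · intro i _ hi
    rw [Matrix.one_apply_ne (Ne.symm hi), map_zero, mul_zero]
  · intro h; exact absurd (Finset.mem_univ l) h

/-- The univariate factors of the duality trick: `E_{w,u}(y) = Σ_{i ≤ w} (u^i / i!) y^i`.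
[cite: GuptaKamathKayalSaptharishi2016, Lemma 4.6] -/
noncomputable def dualFactor (w u : ℕ) (y : A) : A :=
  ∑ i ∈ Finset.range (w + 1), (((u : k) ^ i) * ((i.factorial : k)⁻¹)) • y ^ i

/-- **Saxena's duality trick**: a power of a sum is a short sum of products of univariates.
[cite: GuptaKamathKayalSaptharishi2016, Lemma 4.6 (Saxena's duality trick)] -/
theorem saxena_duality {ι : Type*} [Fintype ι] [DecidableEq ι] (g : ι → A) (w : ℕ) :
    ∃ β : Fin ((Fintype.card ι + 1) * w + 1) → k,
      (∑ j, g j) ^ w = ∑ u, β u • ∏ j, dualFactor (k := k) w u (g j) := by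
  set N := (Fintype.card ι + 1) * w with hN
  set P : Polynomial A := ∏ j, texp (k := k) w (g j) with hPdef
  have hPdeg : P.natDegree ≤ N := by
    refine (Polynomial.natDegree_prod_le _ _).trans ?_
    refine (Finset.sum_le_sum fun j _ => natDegree_texp_le (k := k) w (g j)).trans ?_
    simp only [Finset.sum_const, Finset.card_univ, smul_eq_mul, hN]
    nlinarith
  let α : Fin (N + 1) → k := fun u => (u.val : k)
  have hα : Function.Injective α := by
    intro u v huv
    have huv' : ((u.val : ℕ) : k) = (v.val : ℕ) := huv
    exact Fin.ext (by exact_mod_cast huv')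
  have hw : w < N + 1 := by rw [hN]; nlinarith
  have hcoeff : P.coeff w = ((w.factorial : k)⁻¹) • (∑ j, g j) ^ w := by
    rw [hPdef, coeff_prod_texp w g Finset.univ w le_rfl, coeff_texp, if_pos le_rfl]
  have hextr := coeff_eq_sum_vandermonde_inv P hPdeg α hα ⟨w, hw⟩
  have hw0 : (w.factorial : k) ≠ 0 := by exact_mod_cast Nat.factorial_ne_zero w
  refine ⟨fun u => (w.factorial : k) * (Matrix.vandermonde α)⁻¹ ⟨w, hw⟩ u, ?_⟩
  have : (∑ j, g j) ^ w = (w.factorial : k) • P.coeff w := by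
    rw [hcoeff, smul_smul, mul_inv_cancel₀ hw0, one_smul]
  rw [this, hextr, Finset.smul_sum]
  apply Finset.sum_congr rfl
  intro u _
  rw [smul_smul]
  congr 1
  rw [hPdef, Polynomial.eval_prod]
  apply Finset.prod_congr rfl
  intro j _
  unfold texp dualFactor
  rw [Polynomial.eval_finsetSum]
  apply Finset.sum_congr rfl
  intro i _
  rw [Polynomial.eval_mul, Polynomial.eval_C, Polynomial.eval_pow, Polynomial.eval_X,
    ← map_pow, Algebra.smul_def, Algebra.smul_def, map_mul, map_pow, map_natCast]
  ring

end Duality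



/-! ### ΣΠΣ expressions -/

section SPS

open MvPolynomial

variable {k : Type*} [Field k] {σ : Type*}

/-- An affine form with `t` variable slots: `Σ_{i<t} w i • X (v i) + C c`.
[cite: GuptaKamathKayalSaptharishi2016, §1, eq. (1) (affine forms `ℓᵢⱼ`)] -/
structure AffForm (k : Type*) (σ : Type*) (t : ℕ) where
  /-- weights of the variable slots -/
  w : Fin t → k
  /-- variables of the slots -/
  v : Fin t → σ
  /-- constant term -/
  c : k

namespace AffForm

variable {t : ℕ}

/-- The value of an affine form. [folklore] -/
noncomputable def val (φ : AffForm k σ t) : MvPolynomial σ k := (∑ i, φ.w i • X (φ.v i)) + C φ.c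

/-- The constant affine form `1` (all weights zero). [folklore] -/
def one [Inhabited σ] : AffForm k σ t := ⟨fun _ => 0, fun _ => default, 1⟩

/-- The constant form evaluates to `1`. [folklore] -/
theorem val_one [Inhabited σ] : (one : AffForm k σ t).val = 1 := by simp [val, one]

/-- Shift the constant term by `-ρ`. [folklore] -/
def shift (φ : AffForm k σ t) (ρ : k) : AffForm k σ t := ⟨φ.w, φ.v, φ.c - ρ⟩

/-- Shifting the constant subtracts it from the value. [folklore] -/
theorem val_shift (φ : AffForm k σ t) (ρ : k) : (φ.shift ρ).val = φ.val - C ρ := by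
  simp only [val, shift, map_sub]
  ring

end AffForm

/-- `f` is a sum of at most `U` scalar multiples of products of `D` affine forms with `t` slots.
[cite: GuptaKamathKayalSaptharishi2016, §1, eq. (1) (`ΣΠΣ` circuits `Σᵢ ∏ⱼ ℓᵢⱼ`)] -/
def IsSPS (U D t : ℕ) (f : MvPolynomial σ k) : Prop :=
  ∃ (c : Fin U → k) (φ : Fin U → Fin D → AffForm k σ t), f = ∑ i, c i • ∏ j, (φ i j).val

namespace IsSPS

variable {t : ℕ}

/-- `0` is an empty `ΣΠΣ` expression. [folklore] -/
theorem zero {D : ℕ} : IsSPS 0 D t (0 : MvPolynomial σ k) :=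
  ⟨fun i => i.elim0, fun i => i.elim0, by simp⟩

/-- `1` is one empty product. [folklore] -/
theorem one : IsSPS 1 0 t (1 : MvPolynomial σ k) :=
  ⟨fun _ => 1, fun _ j => j.elim0, by simp⟩

/-- A constant is one empty product. [folklore] -/
theorem const (a : k) : IsSPS 1 0 t (C a : MvPolynomial σ k) :=
  ⟨fun _ => a, fun _ j => j.elim0, by simp [MvPolynomial.C_eq_smul_one]⟩

/-- Padding: more terms (zero coefficients) and more factors (constant forms `1`). [folklore] -/
theorem mono [Inhabited σ] {U D U' D' : ℕ} {f : MvPolynomial σ k} (h : IsSPS U D t f) (hU : U ≤ U')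
    (hD : D ≤ D') : IsSPS U' D' t f := by
  obtain ⟨c, φ, rfl⟩ := h
  obtain ⟨a, rfl⟩ := Nat.exists_eq_add_of_le hU
  obtain ⟨b, rfl⟩ := Nat.exists_eq_add_of_le hD
  refine ⟨Fin.append c (fun _ => 0), fun i =>
    Fin.addCases (motive := fun _ => Fin (D + b) → AffForm k σ t)
      (fun i0 => Fin.append (φ i0) (fun _ => AffForm.one)) (fun _ _ => AffForm.one) i, ?_⟩
  rw [Fin.sum_univ_add]
  simp only [Fin.append_left, Fin.append_right, Fin.addCases_left, Fin.addCases_right, zero_smul,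
    Finset.sum_const_zero, add_zero]
  apply Finset.sum_congr rfl
  intro i _
  congr 1
  rw [Fin.prod_univ_add]
  simp [Fin.append_left, Fin.append_right, AffForm.val_one]

/-- Sums of `ΣΠΣ` expressions. [folklore] -/
theorem add {U₁ U₂ D : ℕ} {f g : MvPolynomial σ k} (hf : IsSPS U₁ D t f) (hg : IsSPS U₂ D t g) :
    IsSPS (U₁ + U₂) D t (f + g) := by
  obtain ⟨c₁, φ₁, rfl⟩ := hf
  obtain ⟨c₂, φ₂, rfl⟩ := hg
  refine ⟨Fin.append c₁ c₂, Fin.append φ₁ φ₂, ?_⟩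
  rw [Fin.sum_univ_add]
  simp [Fin.append_left, Fin.append_right]

/-- Scalar multiples of `ΣΠΣ` expressions. [folklore] -/
theorem smul {U D : ℕ} {f : MvPolynomial σ k} (hf : IsSPS U D t f) (a : k) :
    IsSPS U D t (a • f) := by
  obtain ⟨c, φ, rfl⟩ := hf
  refine ⟨fun i => a * c i, φ, ?_⟩
  rw [Finset.smul_sum]
  simp [smul_smul]

/-- Finite sums of `ΣΠΣ` expressions. [folklore] -/
theorem sum {ι : Type*} [DecidableEq ι] {U D : ℕ} (s : Finset ι) (f : ι → MvPolynomial σ k)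
    (h : ∀ i ∈ s, IsSPS U D t (f i)) : IsSPS (s.card * U) D t (∑ i ∈ s, f i) := by
  induction s using Finset.induction_on with
  | empty => simpa using IsSPS.zero
  | @insert a s ha ih =>
    rw [Finset.sum_insert ha, Finset.card_insert_of_notMem ha, add_mul, one_mul,
      add_comm (s.card * U)]
    exact (h a (Finset.mem_insert_self a s)).add (ih fun i hi => h i (Finset.mem_insert_of_mem hi))

/-- Finite sums of `ΣΠΣ` expressions over a finite type. [folklore] -/
theorem sum_fintype {ι : Type*} [Fintype ι] [DecidableEq ι] {U D : ℕ} (f : ι → MvPolynomial σ k)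
    (h : ∀ i, IsSPS U D t (f i)) : IsSPS (Fintype.card ι * U) D t (∑ i, f i) := by
  rw [← Finset.card_univ]
  exact IsSPS.sum Finset.univ f fun i _ => h i

/-- The product of two single products is a single product. [folklore] -/
theorem mul {D₁ D₂ : ℕ} {f g : MvPolynomial σ k} (hf : IsSPS 1 D₁ t f) (hg : IsSPS 1 D₂ t g) :
    IsSPS 1 (D₁ + D₂) t (f * g) := by
  obtain ⟨c₁, φ₁, rfl⟩ := hf
  obtain ⟨c₂, φ₂, rfl⟩ := hg
  refine ⟨fun _ => c₁ 0 * c₂ 0, fun _ => Fin.append (φ₁ 0) (φ₂ 0), ?_⟩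
  simp only [Finset.univ_unique, Fin.default_eq_zero, Finset.sum_singleton]
  rw [Fin.prod_univ_add]
  simp only [Fin.append_left, Fin.append_right]
  rw [smul_mul_smul_comm]

/-- Finite products of single products. [folklore] -/
theorem prod {ι : Type*} [DecidableEq ι] {D : ℕ} (s : Finset ι) (f : ι → MvPolynomial σ k)
    (h : ∀ i ∈ s, IsSPS 1 D t (f i)) : IsSPS 1 (s.card * D) t (∏ i ∈ s, f i) := by
  induction s using Finset.induction_on with
  | empty => simpa using IsSPS.one
  | @insert a s ha ih =>
    rw [Finset.prod_insert ha, Finset.card_insert_of_notMem ha, add_mul, one_mul,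
      add_comm (s.card * D)]
    exact (h a (Finset.mem_insert_self a s)).mul (ih fun i hi => h i (Finset.mem_insert_of_mem hi))

/-- Finite products of single products over a finite type. [folklore] -/
theorem prod_fintype {ι : Type*} [Fintype ι] [DecidableEq ι] {D : ℕ} (f : ι → MvPolynomial σ k)
    (h : ∀ i, IsSPS 1 D t (f i)) : IsSPS 1 (Fintype.card ι * D) t (∏ i, f i) := by
  rw [← Finset.card_univ]
  exact IsSPS.prod Finset.univ f fun i _ => h i

/-- A univariate polynomial of degree `≤ D` evaluated at an affine form is ONE product of at most
`D` affine forms, over an algebraically closed field.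
[cite: GuptaKamathKayalSaptharishi2016, proof of Lemma 4.7 (univariates split into linear factors)] -/
theorem aeval [Inhabited σ] [IsAlgClosed k] {D : ℕ} (φ : AffForm k σ t) (q : Polynomial k)
    (hq : q.natDegree ≤ D) : IsSPS 1 D t (Polynomial.aeval φ.val q) := by
  have hs : q.Splits := IsAlgClosed.splits q
  set rs := q.roots.toList with hrs
  have hlen : rs.length ≤ D := by
    rw [hrs, Multiset.length_toList, ← hs.natDegree_eq_card_roots]; exact hq
  have hq' : Polynomial.aeval φ.val q =
      q.leadingCoeff • ∏ i : Fin rs.length, (φ.shift (rs[i.1])).val := by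
    conv_lhs => rw [hs.eq_prod_roots]
    rw [map_mul, Polynomial.aeval_C, map_multiset_prod, Multiset.map_map,
      Fin.prod_univ_fun_getElem rs (fun ρ => (φ.shift ρ).val), ← Multiset.prod_coe,
      ← Multiset.map_coe, hrs, Multiset.coe_toList, MvPolynomial.algebraMap_eq,
      ← MvPolynomial.smul_eq_C_mul]
    congr 2
    apply Multiset.map_congr rfl
    intro ρ _
    simp [AffForm.val_shift]
  rw [hq']
  have h1 : IsSPS 1 rs.length t (∏ i : Fin rs.length, (φ.shift (rs[i.1])).val) :=
    ⟨fun _ => 1, fun _ i => φ.shift (rs[i.1]), by simp⟩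
  exact (h1.smul _).mono le_rfl hlen

end IsSPS

end SPS


/-! ### Fischer's identity for monomials and the sparse expansion -/

section Monomials

open MvPolynomial

variable {k : Type*} [Field k] {σ : Type*}

/-- The variables of a monomial, listed with multiplicity. [folklore] -/
noncomputable def varList (m : σ →₀ ℕ) : List σ := (Finsupp.toMultiset m).toList

/-- The degree of a monomial, as the length of its list of variables. [folklore] -/
noncomputable def mdeg (m : σ →₀ ℕ) : ℕ := (varList m).length

/-- `mdeg` is the degree of the monomial. [folklore] -/
theorem mdeg_eq_degree (m : σ →₀ ℕ) : mdeg m = m.degree := by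
  rw [mdeg, varList, Multiset.length_toList, Finsupp.card_toMultiset, Finsupp.degree]
  rfl

/-- Monomials of the support have degree at most the total degree. [folklore] -/
theorem mdeg_le_totalDegree {P : MvPolynomial σ k} {m : σ →₀ ℕ} (hm : m ∈ P.support) :
    mdeg m ≤ P.totalDegree := by
  rw [mdeg_eq_degree]
  exact le_totalDegree hm

/-- `X^m` is the product of its variables. [folklore] -/
theorem prod_varList (m : σ →₀ ℕ) :
    ((varList m).map (X : σ → MvPolynomial σ k)).prod = monomial m 1 := by
  rw [varList, ← Multiset.prod_coe, ← Multiset.map_coe, Multiset.coe_toList, Finsupp.toMultiset_map,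
    Finsupp.prod_toMultiset,
    Finsupp.prod_mapDomain_index (fun _ => pow_zero _) (fun _ _ _ => pow_add _ _ _)]
  exact prod_X_pow_eq_monomial

/-- The slots `< e`. [folklore] -/
def slots (e t : ℕ) : Finset (Fin t) := Finset.univ.filter fun i => i.val < e

/-- The slots `< e ≤ t` are the image of `Fin e`. [folklore] -/
theorem slots_eq_map {e t : ℕ} (h : e ≤ t) :
    slots e t = (Finset.univ : Finset (Fin e)).map (Fin.castLEEmb h) := by
  ext i
  simp only [slots, Finset.mem_filter, Finset.mem_univ, true_and, Finset.mem_map,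
    Fin.castLEEmb_apply]
  constructor
  · intro hi; exact ⟨⟨i.val, hi⟩, Fin.ext rfl⟩
  · rintro ⟨j, rfl⟩; exact j.isLt

/-- There are `e` slots `< e`. [folklore] -/
theorem card_slots {e t : ℕ} (h : e ≤ t) : (slots e t).card = e := by
  rw [slots_eq_map h, Finset.card_map, Finset.card_univ, Fintype.card_fin]

/-- The Fischer coefficient of the subset `S` for a monomial of degree `e`.
[cite: GuptaKamathKayalSaptharishi2016, Lemma 4.3] -/
noncomputable def fischerCoeff (e t : ℕ) (S : Finset (Fin t)) : k :=
  if S ⊆ slots e t then (-1) ^ (e - S.card) * ((e.factorial : k)⁻¹) else 0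

variable [Inhabited σ]

/-- Slot `i < mdeg m` holds the `i`-th variable of `m`; later slots are padding. [folklore] -/
noncomputable def slotVar (m : σ →₀ ℕ) (t : ℕ) (i : Fin t) : σ := ((varList m)[i.val]?).getD default

/-- The Fischer linear form `Σ_{i ∈ S} X (slotVar m i)`.
[cite: GuptaKamathKayalSaptharishi2016, Lemma 4.3] -/
noncomputable def fischerForm (m : σ →₀ ℕ) (t : ℕ) (S : Finset (Fin t)) : AffForm k σ t :=
  ⟨fun i => if i ∈ S then 1 else 0, slotVar m t, 0⟩

/-- The value of a Fischer form. [folklore] -/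
theorem val_fischerForm (m : σ →₀ ℕ) (t : ℕ) (S : Finset (Fin t)) :
    (fischerForm (k := k) m t S).val = ∑ i ∈ S, X (slotVar m t i) := by
  simp only [AffForm.val, fischerForm, ite_smul, one_smul, zero_smul, map_zero, add_zero]
  rw [Finset.sum_ite_mem, Finset.univ_inter]

/-- **Fischer's lemma** [GKKS Lemma 4.3]: a monomial of degree `e ≤ t` is a linear combination of
`2^t` `e`-th powers of linear forms with `t` slots.
[cite: GuptaKamathKayalSaptharishi2016, Lemma 4.3 and the corollary after it] -/
theorem monomial_fischer [CharZero k] (m : σ →₀ ℕ) {t : ℕ} (h : mdeg m ≤ t) :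
    (monomial m (1 : k)) = ∑ S : Finset (Fin t),
      fischerCoeff (k := k) (mdeg m) t S • (fischerForm (k := k) m t S).val ^ (mdeg m) := by
  have hfis :=
    fischer_ryser (A := MvPolynomial σ k) (fun i : Fin t => X (slotVar m t i)) (slots (mdeg m) t)
  rw [card_slots h] at hfis
  have hprod : ∏ i ∈ slots (mdeg m) t, (X (slotVar m t i) : MvPolynomial σ k) = monomial m 1 := by
    rw [slots_eq_map h, Finset.prod_map, ← prod_varList (k := k) m,
      ← Fin.prod_univ_fun_getElem (varList m) (X : σ → MvPolynomial σ k)]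
    change ∏ x : Fin (varList m).length, X (slotVar m t (Fin.castLEEmb h x)) =
      ∏ i : Fin (varList m).length, X (varList m)[i.1]
    apply Finset.prod_congr rfl
    intro i _
    simp only [Fin.castLEEmb_apply, slotVar, Fin.val_castLE]
    rw [List.getElem?_eq_getElem i.isLt]
    rfl
  rw [hprod] at hfis
  have he0 : ((mdeg m).factorial : k) ≠ 0 := by exact_mod_cast Nat.factorial_ne_zero (mdeg m)
  have hlhs : (monomial m (1 : k)) = (((mdeg m).factorial : k)⁻¹) •
      (((mdeg m).factorial : MvPolynomial σ k) * monomial m 1) := by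
    rw [← map_natCast (algebraMap k (MvPolynomial σ k)), ← Algebra.smul_def, smul_smul,
      inv_mul_cancel₀ he0, one_smul]
  rw [hlhs, hfis, Finset.smul_sum]
  have hpow : (slots (mdeg m) t).powerset = Finset.univ.filter fun S => S ⊆ slots (mdeg m) t := by
    ext S; simp
  rw [hpow, Finset.sum_filter]
  apply Finset.sum_congr rfl
  intro S _
  unfold fischerCoeff
  split_ifs with hS
  · rw [val_fischerForm, ← map_one (algebraMap k (MvPolynomial σ k)), ← map_neg, ← map_pow,
      ← Algebra.smul_def, smul_smul, mul_comm]
  · rw [zero_smul]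

/-- The sparse Fischer expansion [GKKS Lemma 4.4, bottom layer]: a polynomial of degree `≤ t` is
a linear combination, indexed by (monomial of the support) × (subset of the `t` slots), of powers
of linear forms.
[cite: GuptaKamathKayalSaptharishi2016, Lemma 4.4 (proof: apply Lemma 4.3 to each monomial)] -/
theorem sparse_fischer [CharZero k] {t : ℕ} (P : MvPolynomial σ k) (hP : P.totalDegree ≤ t) :
    P = ∑ j : ↥P.support × Finset (Fin t),
      (coeff j.1.1 P * fischerCoeff (k := k) (mdeg j.1.1) t j.2) •
        (fischerForm (k := k) j.1.1 t j.2).val ^ (mdeg j.1.1) := by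
  conv_lhs => rw [P.as_sum]
  rw [Fintype.sum_prod_type, ← Finset.sum_coe_sort P.support]
  apply Finset.sum_congr rfl
  rintro ⟨m, hm⟩ _
  have hmt : mdeg m ≤ t := (mdeg_le_totalDegree hm).trans hP
  simp only
  rw [show monomial m (coeff m P) = coeff m P • monomial m (1 : k) by
    rw [smul_monomial, smul_eq_mul, mul_one], monomial_fischer m hmt, Finset.smul_sum]
  apply Finset.sum_congr rfl
  intro S _
  rw [smul_smul]

end Monomials

/-! ### Counting monomials of bounded degree -/

section Counting

open MvPolynomial

variable {k : Type*} [Field k] {σ : Type*} [Fintype σ] [DecidableEq σ]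

/-- All monomials of degree `≤ t` (a recursively defined superset). [folklore] -/
noncomputable def monos (σ : Type*) [Fintype σ] [DecidableEq σ] : ℕ → Finset (σ →₀ ℕ)
  | 0 => {0}
  | t + 1 =>
    monos σ t ∪ Finset.univ.biUnion fun i => (monos σ t).image fun m => m + Finsupp.single i 1

/-- `0 ∈ monos σ t`. [folklore] -/
theorem zero_mem_monos : ∀ t, (0 : σ →₀ ℕ) ∈ monos σ t
  | 0 => by simp [monos]
  | t + 1 => by simp [monos, zero_mem_monos t]

/-- Every monomial of degree `≤ t` lies in `monos σ t`. [folklore] -/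
theorem mem_monos : ∀ (t : ℕ) (m : σ →₀ ℕ), m.degree ≤ t → m ∈ monos σ t
  | 0, m, hm => by
    have : m = 0 := (Finsupp.degree_eq_zero_iff m).1 (by omega)
    subst this; simp [monos]
  | t + 1, m, hm => by
    by_cases h0 : m = 0
    · subst h0; exact zero_mem_monos _
    · obtain ⟨i, hi⟩ := Finsupp.support_nonempty_iff.2 h0
      have hle : Finsupp.single i 1 ≤ m := by
        rw [Finsupp.single_le_iff]; exact Nat.one_le_iff_ne_zero.2 (Finsupp.mem_support_iff.1 hi)
      set m' := m - Finsupp.single i 1 with hm'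
      have hmm : m = m' + Finsupp.single i 1 := (tsub_add_cancel_of_le hle).symm
      have hdeg : m'.degree ≤ t := by
        have := congrArg Finsupp.degree hmm
        rw [map_add, Finsupp.degree_single] at this
        omega
      simp only [monos, Finset.mem_union, Finset.mem_biUnion, Finset.mem_univ, true_and,
        Finset.mem_image]
      exact Or.inr ⟨i, m', mem_monos t m' hdeg, hmm.symm⟩

/-- `#monos σ t ≤ (#σ + 1)^t`. [folklore] -/
theorem card_monos_le : ∀ t, (monos σ t).card ≤ (Fintype.card σ + 1) ^ t
  | 0 => by simp [monos]
  | t + 1 => by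
    simp only [monos]
    refine (Finset.card_union_le _ _).trans ?_
    refine (Nat.add_le_add_left Finset.card_biUnion_le _).trans ?_
    have : ∑ i : σ, ((monos σ t).image fun m => m + Finsupp.single i 1).card ≤
        Fintype.card σ * (monos σ t).card := by
      refine (Finset.sum_le_sum fun i _ => Finset.card_image_le).trans ?_
      simp
    refine (Nat.add_le_add_left this _).trans ?_
    rw [pow_succ]
    nlinarith [card_monos_le t]

/-- A polynomial of degree `≤ t` in `N` variables has at most `(N+1)^t` monomials.
[cite: GuptaKamathKayalSaptharishi2016, proof of Lemma 4.4 (sparsity of the `Qᵢⱼ`)] -/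
theorem card_support_le {t : ℕ} (P : MvPolynomial σ k) (hP : P.totalDegree ≤ t) :
    P.support.card ≤ (Fintype.card σ + 1) ^ t := by
  refine (Finset.card_le_card ?_).trans (card_monos_le t)
  intro m hm
  apply mem_monos
  rw [← mdeg_eq_degree]
  exact (mdeg_le_totalDegree hm).trans hP

end Counting


/-! ### The pipeline: products of low-degree polynomials are short ΣΠΣ expressions -/

section Pipeline

open MvPolynomial

variable {k : Type*} [Field k] [CharZero k] [IsAlgClosed k]
variable {σ : Type*} [Fintype σ] [DecidableEq σ] [Inhabited σ]

/-- The bound on the number of (monomial, slot subset) pairs: `(N+1)^t 2^t`.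
[cite: GuptaKamathKayalSaptharishi2016, Lemma 4.4 (size `(b s₁ n) 2^b` of the bottom layer)] -/
def mmax (N t : ℕ) : ℕ := (N + 1) ^ t * 2 ^ t

omit [CharZero k] [Fintype σ] [DecidableEq σ] in
/-- A duality factor `E_{w,u}(γ ℓ^e)` is one product of at most `e w` affine forms.
[cite: GuptaKamathKayalSaptharishi2016, proof of Lemma 4.7] -/
theorem isSPS_dualFactor {t D : ℕ} (φ : AffForm k σ t) (γ : k) (e w u : ℕ) (h : e * w ≤ D) :
    IsSPS 1 D t (dualFactor (k := k) w u (γ • φ.val ^ e)) := by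
  set q : Polynomial k := ∑ i ∈ Finset.range (w + 1),
    Polynomial.C (((u : k) ^ i * ((i.factorial : k)⁻¹)) * γ ^ i) * Polynomial.X ^ (e * i) with hq
  have hdeg : q.natDegree ≤ D := by
    rw [hq]
    apply Polynomial.natDegree_sum_le_of_forall_le
    intro i hi
    simp only [Finset.mem_range] at hi
    refine (Polynomial.natDegree_C_mul_X_pow_le _ _).trans ?_
    calc e * i ≤ e * w := Nat.mul_le_mul_left e (by omega)
      _ ≤ D := h
  have hval : dualFactor (k := k) w u (γ • φ.val ^ e) = Polynomial.aeval φ.val q := by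
    rw [hq, map_sum, dualFactor]
    apply Finset.sum_congr rfl
    intro i _
    rw [map_mul, Polynomial.aeval_C, map_pow, Polynomial.aeval_X, smul_pow, ← pow_mul,
      MvPolynomial.algebraMap_eq, ← MvPolynomial.smul_eq_C_mul, smul_smul]
  rw [hval]
  exact IsSPS.aeval φ q hdeg

/-- [GKKS Lemma 4.6/4.7] A power `P^w`, `w ≤ W`, of a polynomial of degree `≤ t` in `N` variables
is a sum of at most `(mmax N t + 1) W + 1` products of at most `mmax N t · t · W` affine forms.
[cite: GuptaKamathKayalSaptharishi2016, Lemmas 4.6 and 4.7] -/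
theorem isSPS_pow {t W : ℕ} (P : MvPolynomial σ k) (hP : P.totalDegree ≤ t) (w : ℕ) (hw : w ≤ W) :
    IsSPS ((mmax (Fintype.card σ) t + 1) * W + 1) (mmax (Fintype.card σ) t * (t * W)) t
      (P ^ w) := by
  let ι := ↥P.support × Finset (Fin t)
  have hcard : Fintype.card ι ≤ mmax (Fintype.card σ) t := by
    simp only [ι, Fintype.card_prod, Fintype.card_coe, Fintype.card_finset, Fintype.card_fin, mmax]
    exact Nat.mul_le_mul_right _ (card_support_le P hP)
  set g : ι → MvPolynomial σ k := fun j =>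
    (coeff j.1.1 P * fischerCoeff (k := k) (mdeg j.1.1) t j.2) •
      (fischerForm (k := k) j.1.1 t j.2).val ^ (mdeg j.1.1) with hg
  have hPg : P = ∑ j, g j := sparse_fischer P hP
  obtain ⟨β, hβ⟩ := saxena_duality (k := k) g w
  rw [hPg, hβ]
  have hterm : ∀ u : Fin ((Fintype.card ι + 1) * w + 1),
      IsSPS 1 (mmax (Fintype.card σ) t * (t * W)) t (β u • ∏ j, dualFactor (k := k) w u (g j)) := by
    intro u
    refine (IsSPS.prod_fintype _ fun j => ?_).smul _ |>.mono le_rfl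
      (Nat.mul_le_mul_right _ hcard)
    rw [hg]
    apply isSPS_dualFactor
    exact Nat.mul_le_mul ((mdeg_le_totalDegree j.1.2).trans hP) hw
  refine (IsSPS.sum_fintype _ hterm).mono ?_ le_rfl
  rw [Fintype.card_fin, mul_one]
  calc (Fintype.card ι + 1) * w + 1 ≤ (mmax (Fintype.card σ) t + 1) * W + 1 := by
        apply Nat.add_le_add_right
        exact Nat.mul_le_mul (Nat.add_le_add_right hcard 1) hw

/-- [GKKS Lemma 4.3/4.4, top layer] A product of `w ≤ W` polynomials of degree `≤ t` is a sum of
at most `2^W ((mmax+1) W + 1)` products of at most `mmax · t · W` affine forms.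
[cite: GuptaKamathKayalSaptharishi2016, Lemmas 4.3, 4.4 and 4.7] -/
theorem isSPS_prod_lowdeg {t W : ℕ} (w : ℕ) (hw : w ≤ W) (p : Fin w → MvPolynomial σ k)
    (hp : ∀ i, (p i).totalDegree ≤ t) :
    IsSPS (2 ^ W * ((mmax (Fintype.card σ) t + 1) * W + 1)) (mmax (Fintype.card σ) t * (t * W)) t
      (∏ i, p i) := by
  have hfis := fischer_ryser (A := MvPolynomial σ k) p Finset.univ
  rw [Finset.card_univ, Fintype.card_fin, Finset.powerset_univ] at hfis
  have hw0 : (w.factorial : k) ≠ 0 := by exact_mod_cast Nat.factorial_ne_zero w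
  have hlhs : ∏ i, p i = ((w.factorial : k)⁻¹) • ((w.factorial : MvPolynomial σ k) * ∏ i, p i) := by
    rw [← map_natCast (algebraMap k (MvPolynomial σ k)), ← Algebra.smul_def, smul_smul,
      inv_mul_cancel₀ hw0, one_smul]
  rw [hlhs, hfis]
  refine IsSPS.smul ?_ _
  have hterm : ∀ S : Finset (Fin w),
      IsSPS ((mmax (Fintype.card σ) t + 1) * W + 1) (mmax (Fintype.card σ) t * (t * W)) t
        ((-1 : MvPolynomial σ k) ^ (w - S.card) * (∑ i ∈ S, p i) ^ w) := by
    intro S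
    rw [← map_one (algebraMap k (MvPolynomial σ k)), ← map_neg, ← map_pow, ← Algebra.smul_def]
    refine IsSPS.smul ?_ _
    apply isSPS_pow _ _ w hw
    exact totalDegree_finsetSum_le fun i _ => hp i
  refine (IsSPS.sum_fintype _ hterm).mono ?_ le_rfl
  rw [Fintype.card_finset, Fintype.card_fin]
  exact Nat.mul_le_mul_right _ (Nat.pow_le_pow_right (by norm_num) hw)

/-- The depth-three normal form of a sum of products of low-degree polynomials.
[cite: GuptaKamathKayalSaptharishi2016, §4, Steps 1–3] -/
theorem isSPS_of_lists {t W T₀ : ℕ} (L : List (List (MvPolynomial σ k))) (hL : L.length ≤ T₀)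
    (hT : ∀ τ ∈ L, τ.length ≤ W ∧ ∀ p ∈ τ, p.totalDegree ≤ t) :
    IsSPS (T₀ * (2 ^ W * ((mmax (Fintype.card σ) t + 1) * W + 1)))
      (mmax (Fintype.card σ) t * (t * W)) t (L.map List.prod).sum := by
  rw [← Fin.sum_univ_fun_getElem]
  have hterm : ∀ τ : Fin L.length,
      IsSPS (2 ^ W * ((mmax (Fintype.card σ) t + 1) * W + 1)) (mmax (Fintype.card σ) t * (t * W)) t
        (L[τ.1]).prod := by
    intro τ
    obtain ⟨hlen, hdeg⟩ := hT _ (List.getElem_mem τ.2)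
    rw [← Fin.prod_univ_getElem]
    exact isSPS_prod_lowdeg _ hlen _ fun i => hdeg _ (List.getElem_mem i.2)
  refine (IsSPS.sum_fintype _ hterm).mono ?_ le_rfl
  rw [Fintype.card_fin]
  exact Nat.mul_le_mul_right _ hL

end Pipeline


/-! ### The `ΣΠΣ` builder in the `ArithCircuit` model -/

section Builder

open MvPolynomial ArithCircuit Literature.Computability.AlgebraicComplexity.DepthReduction

universe u v

variable {k : Type u} [Field k] {σ : Type v} {t U D : ℕ}

/-- The weighted-sum gate of an affine form: `t` variable wires and one constant wire.
[cite: GuptaKamathKayalSaptharishi2016, §3 (size = wires)] -/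
def formGate (ψ : AffForm k σ t) : Gate k σ :=
  .sum ((List.ofFn fun i : Fin t => (ψ.w i, Operand.var (ψ.v i))) ++ [(ψ.c, Operand.const 1)])

omit [Field k] in
/-- An affine-form gate has `t + 1` wires. [folklore] -/
theorem fanIn_formGate [Field k] (ψ : AffForm k σ t) : (formGate ψ).fanIn = t + 1 := by
  simp [formGate, Gate.fanIn, Gate.args]

/-- An affine-form gate computes the affine form. [folklore] -/
theorem eval_formGate (vals : List (MvPolynomial σ k)) (ψ : AffForm k σ t) :
    (formGate ψ).eval vals = ψ.val := by
  simp only [formGate, Gate.eval, List.map_append, List.map_ofFn, List.sum_append, List.sum_ofFn,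
    List.map_singleton, List.sum_singleton, AffForm.val]
  congr 1
  simp [Operand.eval, MvPolynomial.smul_eq_C_mul]

omit [Field k] in
/-- An affine-form gate refers to no gate. [folklore] -/
theorem refs_formGate [Field k] (ψ : AffForm k σ t) (n : ℕ) :
    ∀ u ∈ (formGate ψ).args, u.RefsBelow n := by
  intro u hu
  simp only [formGate, Gate.args, List.map_append, List.map_ofFn, List.mem_append, List.mem_ofFn,
    List.map_singleton, List.mem_singleton] at hu
  rcases hu with ⟨i, rfl⟩ | rfl <;> trivial

omit [Field k] in
/-- The operands of an affine-form gate have depth `0`. [folklore] -/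
theorem depth_args_formGate [Field k] (ψ : AffForm k σ t) (ds : List ℕ) :
    ((formGate ψ).args.map (Operand.depthIn ds)).foldr max 0 = 0 := by
  apply Nat.eq_zero_of_le_zero
  apply foldr_max_le
  intro x hx
  obtain ⟨u, hu, rfl⟩ := List.mem_map.1 hx
  simp only [formGate, Gate.args, List.map_append, List.map_ofFn, List.mem_append, List.mem_ofFn,
    List.map_singleton, List.mem_singleton] at hu
  rcases hu with ⟨i, rfl⟩ | rfl <;> exact le_rfl

variable (c : Fin U → k) (φ : Fin U → Fin D → AffForm k σ t)

/-- Layer 1: the `U · D` affine forms, form `(i, j)` at index `finProdFinEquiv (i, j)`.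
[cite: GuptaKamathKayalSaptharishi2016, §4.3, proof of Lemma 4.7] -/
def layerF : List (Gate k σ) :=
  (List.finRange (U * D)).map fun q =>
    formGate (φ (finProdFinEquiv.symm q).1 (finProdFinEquiv.symm q).2)

/-- Layer 2: one product gate per term. [cite: GuptaKamathKayalSaptharishi2016, §4.3] -/
def layerQ (U D : ℕ) : List (Gate k σ) :=
  (List.finRange U).map fun i => .prod ((List.finRange D).map fun j =>
    Operand.gate (finProdFinEquiv (i, j)).val)

/-- Layer 3: the weighted output sum. [cite: GuptaKamathKayalSaptharishi2016, §4.3] -/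
def outGate (D : ℕ) : Gate k σ :=
  .sum ((List.finRange U).map fun i => (c i, Operand.gate (U * D + i.val)))

/-- The `ΣΠΣ` circuit of a `ΣΠΣ` expression.
[cite: GuptaKamathKayalSaptharishi2016, §4.3, eq. (1)] -/
def slotCircuit : ArithCircuit k σ where
  gates := layerF φ ++ layerQ (k := k) (σ := σ) U D ++ [outGate c D]
  output := .gate (U * D + U)

omit [Field k] in
/-- Layer 1 has `U · D` gates. [folklore] -/
theorem length_layerF [Field k] (φ : Fin U → Fin D → AffForm k σ t) :
    (layerF φ).length = U * D := by simp [layerF]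

omit [Field k] in
/-- Layer 2 has `U` gates. [folklore] -/
theorem length_layerQ [Field k] : (layerQ (k := k) (σ := σ) U D).length = U := by simp [layerQ]

/-- Values of layer 1: the affine forms. [folklore] -/
theorem gateValues_layerF :
    gateValues (layerF φ) = (List.finRange (U * D)).map fun q =>
      (φ (finProdFinEquiv.symm q).1 (finProdFinEquiv.symm q).2).val := by
  have := gateValues_layer (k := k) (σ := σ) [] (layerF φ) (by
    intro g hg u hu
    simp only [layerF, List.mem_map] at hg
    obtain ⟨q, -, rfl⟩ := hg
    exact refs_formGate _ _ u hu)
  simp only [List.nil_append] at this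
  rw [this]
  simp [gateValues, layerF, eval_formGate]

omit [Field k] in
/-- Layer 2 refers only to layer 1. [folklore] -/
theorem refs_layerQ [Field k] (φ : Fin U → Fin D → AffForm k σ t) :
    ∀ g ∈ layerQ (k := k) (σ := σ) U D, ∀ u ∈ g.args, u.RefsBelow (layerF φ).length := by
  intro g hg u hu
  simp only [layerQ, List.mem_map] at hg
  obtain ⟨i, -, rfl⟩ := hg
  simp only [Gate.args, List.mem_map] at hu
  obtain ⟨j, -, rfl⟩ := hu
  simp only [Operand.RefsBelow, length_layerF]
  exact (finProdFinEquiv (i, j)).isLt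

/-- Values of layers 1–2: the affine forms, then the products. [folklore] -/
theorem gateValues_layerFQ :
    gateValues (layerF φ ++ layerQ (k := k) (σ := σ) U D) =
      ((List.finRange (U * D)).map fun q =>
        (φ (finProdFinEquiv.symm q).1 (finProdFinEquiv.symm q).2).val) ++
      (List.finRange U).map fun i => ∏ j, (φ i j).val := by
  rw [gateValues_layer _ _ (refs_layerQ φ), gateValues_layerF]
  congr 1
  simp only [layerQ, List.map_map]
  apply List.map_congr_left
  intro i _
  simp only [Function.comp, Gate.eval, List.map_map]
  rw [← Fin.prod_univ_def]
  apply Fintype.prod_congr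
  intro j
  simp only [Function.comp, Operand.eval, List.getD_eq_getElem?_getD]
  rw [List.getElem?_map, List.getElem?_eq_getElem (by
      rw [List.length_finRange]; exact (finProdFinEquiv (i, j)).isLt)]
  simp only [List.getElem_finRange, Fin.cast_mk, Option.map_some, Option.getD_some, Fin.eta,
    Equiv.symm_apply_apply]

omit [Field k] in
/-- The output gate refers only to layers 1–2. [folklore] -/
theorem refs_out [Field k] (c : Fin U → k) (φ : Fin U → Fin D → AffForm k σ t) :
    ∀ g ∈ ([outGate c D] : List (Gate k σ)), ∀ u ∈ g.args,
      u.RefsBelow (layerF φ ++ layerQ (k := k) (σ := σ) U D).length := by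
  intro g hg u hu
  simp only [List.mem_singleton] at hg
  subst hg
  simp only [outGate, Gate.args, List.map_map, List.mem_map] at hu
  obtain ⟨i, -, rfl⟩ := hu
  simp only [Function.comp, Operand.RefsBelow, List.length_append, length_layerF, length_layerQ]
  omega

/-- The `ΣΠΣ` circuit computes its expression.
[cite: GuptaKamathKayalSaptharishi2016, §1, eq. (1)] -/
theorem eval_slotCircuit : (slotCircuit c φ).eval = ∑ i, c i • ∏ j, (φ i j).val := by
  simp only [slotCircuit, ArithCircuit.eval]
  rw [gateValues_layer _ _ (refs_out c φ), gateValues_layerFQ]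
  set vF := (List.finRange (U * D)).map fun q =>
    (φ (finProdFinEquiv.symm q).1 (finProdFinEquiv.symm q).2).val with hvF
  set vQ := (List.finRange U).map fun i => ∏ j, (φ i j).val with hvQ
  have hlF : vF.length = U * D := by simp [hvF]
  have hlQ : vQ.length = U := by simp [hvQ]
  have hl2 : (vF ++ vQ).length = U * D + U := by rw [List.length_append, hlF, hlQ]
  simp only [List.map_singleton, Operand.eval, List.getD_eq_getElem?_getD]
  rw [List.getElem?_append_right (le_of_eq hl2), hl2, Nat.sub_self]
  simp only [List.getElem?_cons_zero, Option.getD_some, outGate, Gate.eval, List.map_map]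
  rw [← Fin.sum_univ_def]
  apply Fintype.sum_congr
  intro i
  simp only [Function.comp, Operand.eval, List.getD_eq_getElem?_getD]
  rw [List.getElem?_append_right (by rw [hlF]; omega), hlF, Nat.add_sub_cancel_left, hvQ,
    List.getElem?_map, List.getElem?_eq_getElem (by simp)]
  simp

omit [Field k] in
/-- The `ΣΠΣ` circuit has product-depth `≤ 1`. [cite: LimayeSrinivasanTavenas2021, §1] -/
theorem productDepth_slotCircuit_le [Field k] (c : Fin U → k) (φ : Fin U → Fin D → AffForm k σ t) :
    (slotCircuit c φ).productDepth ≤ 1 := by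
  unfold ArithCircuit.productDepth ArithCircuit.wdepth
  generalize hw : (fun g : Gate k σ => if g.isProd then 1 else 0) = w
  have hw_prod : ∀ args, w (.prod args) = 1 := fun _ => by rw [← hw]; rfl
  have hw_sum : ∀ args, w (.sum args) = 0 := fun _ => by rw [← hw]; rfl
  have h1 : ∀ x ∈ gateWDepths w (layerF φ), x ≤ 0 := by
    have := gateWDepths_layer w [] (layerF φ) (by
      intro g hg u hu
      simp only [layerF, List.mem_map] at hg
      obtain ⟨q, -, rfl⟩ := hg
      exact refs_formGate _ _ u hu)
    simp only [List.nil_append] at this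
    rw [this]
    intro x hx
    simp only [gateWDepths, List.foldl_nil, List.nil_append, List.mem_map] at hx
    obtain ⟨g, hg, rfl⟩ := hx
    simp only [layerF, List.mem_map] at hg
    obtain ⟨q, -, rfl⟩ := hg
    rw [depth_args_formGate, formGate, hw_sum]
  have h2 : ∀ x ∈ gateWDepths w (layerF φ ++ layerQ (k := k) (σ := σ) U D), x ≤ 1 := by
    rw [gateWDepths_layer w _ _ (refs_layerQ φ)]
    intro x hx
    rcases List.mem_append.1 hx with hx | hx
    · exact (h1 x hx).trans (Nat.zero_le 1)
    · simp only [List.mem_map] at hx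
      obtain ⟨g, hg, rfl⟩ := hx
      simp only [layerQ, List.mem_map] at hg
      obtain ⟨i, -, rfl⟩ := hg
      rw [hw_prod]
      have := foldr_max_le (b := 0) (l := ((Gate.prod ((List.finRange D).map fun j =>
        Operand.gate (finProdFinEquiv (i, j)).val) : Gate k σ).args.map
          (Operand.depthIn (gateWDepths w (layerF φ))))) fun x hx => by
        obtain ⟨u, -, rfl⟩ := List.mem_map.1 hx
        exact depthIn_le h1 u
      omega
  have h3 : ∀ x ∈ gateWDepths w (slotCircuit c φ).gates, x ≤ 1 := by
    simp only [slotCircuit]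
    rw [gateWDepths_layer w _ _ (refs_out c φ)]
    intro x hx
    rcases List.mem_append.1 hx with hx | hx
    · exact h2 x hx
    · simp only [List.map_singleton, List.mem_singleton] at hx
      subst hx
      rw [outGate, hw_sum, zero_add]
      exact foldr_max_le fun x hx => by
        obtain ⟨u, -, rfl⟩ := List.mem_map.1 hx
        exact depthIn_le h2 u
  exact depthIn_le h3 _

omit [Field k] in
/-- Wire count of the `ΣΠΣ` circuit: `U D (t + 1) + U D + U`.
[cite: GuptaKamathKayalSaptharishi2016, §4.3 (size count in the proof of Lemma 4.7)] -/
theorem edgeSize_slotCircuit [Field k] (c : Fin U → k) (φ : Fin U → Fin D → AffForm k σ t) :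
    (slotCircuit c φ).edgeSize = U * (D * (t + 2) + 1) := by
  simp only [ArithCircuit.edgeSize, slotCircuit, List.map_append, List.sum_append,
    List.map_singleton, List.sum_singleton]
  have hF : ((layerF φ).map Gate.fanIn).sum = U * D * (t + 1) := by
    simp only [layerF, List.map_map]
    rw [show (Gate.fanIn ∘ fun q : Fin (U * D) => formGate (φ (finProdFinEquiv.symm q).1
        (finProdFinEquiv.symm q).2)) = fun _ => t + 1 from funext fun q => fanIn_formGate _]
    rw [List.map_const', List.sum_replicate, List.length_finRange, smul_eq_mul]
  have hQ : ((layerQ (k := k) (σ := σ) U D).map Gate.fanIn).sum = U * D := by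
    simp only [layerQ, List.map_map]
    rw [show (Gate.fanIn ∘ fun i : Fin U => (Gate.prod ((List.finRange D).map fun j =>
        Operand.gate (finProdFinEquiv (i, j)).val) : Gate k σ)) = fun _ => D from funext fun i => by
          simp [Gate.fanIn, Gate.args]]
    rw [List.map_const', List.sum_replicate, List.length_finRange, smul_eq_mul]
  have hO : (outGate (σ := σ) c D).fanIn = U := by simp [outGate, Gate.fanIn, Gate.args]
  rw [hF, hQ, hO]
  ring

/-- **From `ΣΠΣ` expressions to `ΣΠΣ` circuits.** [cite: GuptaKamathKayalSaptharishi2016, §3–§4] -/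
theorem IsSPS.exists_circuit {f : MvPolynomial σ k} (h : IsSPS U D t f) :
    ∃ P : ArithCircuit k σ, P.Computes f ∧ P.productDepth ≤ 1 ∧
      P.edgeSize = U * (D * (t + 2) + 1) := by
  obtain ⟨c, φ, rfl⟩ := h
  exact ⟨slotCircuit c φ, eval_slotCircuit c φ, productDepth_slotCircuit_le c φ,
    edgeSize_slotCircuit c φ⟩

end Builder

/-! ### Renaming circuits: wires, product-depth, and the variables that occur -/

section Rename

open MvPolynomial ArithCircuit

universe u v w

variable {k : Type u} {σ : Type v} {τ : Type w}

/-- Renaming a gate does not change its fan-in (private copy of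
`DepthThreeChasm.fanIn_rename`, `DepthThreeChasmCircuits.lean`). [cite: Burgisser2000, Rem. 2.2] -/
private theorem fanIn_rename' (e : σ → τ) (g : Gate k σ) : (g.rename e).fanIn = g.fanIn := by
  cases g <;> simp [Gate.rename, Gate.fanIn, Gate.args]

/-- Renaming preserves the number of wires (private copy of `DepthThreeChasm.edgeSize_rename`).
[cite: Burgisser2000, Rem. 2.2] -/
private theorem edgeSize_rename' (e : σ → τ) (P : ArithCircuit k σ) :
    (P.rename e).edgeSize = P.edgeSize := by
  simp only [edgeSize, ArithCircuit.rename, List.map_map]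
  congr 1
  exact List.map_congr_left fun g _ => fanIn_rename' e g

/-- Renaming an operand does not change its depth (private copy). [folklore] -/
private theorem depthIn_rename' (e : σ → τ) (ds : List ℕ) (u : Operand k σ) :
    (u.rename e).depthIn ds = u.depthIn ds := by
  cases u <;> rfl

/-- The operands of a renamed gate are the renamed operands (private copy). [folklore] -/
private theorem args_rename' (e : σ → τ) (g : Gate k σ) :
    (g.rename e).args = g.args.map (Operand.rename e) := by
  cases g <;> simp [Gate.rename, Gate.args, Function.comp_def]

/-- Renaming preserves the kind of a gate (private copy). [folklore] -/
private theorem isProd_rename' (e : σ → τ) (g : Gate k σ) : (g.rename e).isProd = g.isProd := by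
  cases g <;> rfl

/-- Renaming preserves the product-depth list (private copy). [folklore] -/
private theorem gateWDepths_rename' (e : σ → τ) (gs : List (Gate k σ)) :
    gateWDepths (fun g => if g.isProd then 1 else 0) (gs.map (Gate.rename e)) =
      gateWDepths (fun g => if g.isProd then 1 else 0) gs := by
  induction gs using List.reverseRecOn with
  | nil => rfl
  | append_singleton gs g ih =>
    rw [List.map_append, List.map_singleton, gateWDepths_append_singleton,
      gateWDepths_append_singleton, ih, isProd_rename', args_rename', List.map_map]
    simp only [Function.comp_def, depthIn_rename']

/-- Renaming preserves the product-depth (private copy of `DepthThreeChasm.productDepth_rename`).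
[cite: LimayeSrinivasanTavenas2021, §1] -/
private theorem productDepth_rename' (e : σ → τ) (P : ArithCircuit k σ) :
    (P.rename e).productDepth = P.productDepth := by
  simp only [productDepth, wdepth, ArithCircuit.rename]
  rw [gateWDepths_rename', depthIn_rename']

/-- The variable of an operand, if any. [cite: Burgisser2000, Def. 2.1] -/
def opVars : Operand k σ → List σ
  | .var i => [i]
  | _ => []

/-- An operand mentions at most one variable. [folklore] -/
theorem length_opVars_le (u : Operand k σ) : (opVars u).length ≤ 1 := by
  cases u <;> simp [opVars]

/-- The variables occurring in a circuit (with repetitions). [cite: Burgisser2000, Def. 2.1] -/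
def circVars (P : ArithCircuit k σ) : List σ := P.operands.flatMap opVars

/-- A list of operands mentions at most as many variables as operands. [folklore] -/
theorem length_flatMap_opVars_le (l : List (Operand k σ)) :
    (l.flatMap opVars).length ≤ l.length := by
  induction l with
  | nil => simp
  | cons u l ih =>
    simp only [List.flatMap_cons, List.length_append, List.length_cons]
    have := length_opVars_le u
    omega

/-- A circuit mentions at most `edgeSize + 1` variables. [cite: Burgisser2000, Def. 2.1] -/
theorem length_circVars_le (P : ArithCircuit k σ) : (circVars P).length ≤ P.edgeSize + 1 := by
  refine (length_flatMap_opVars_le _).trans ?_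
  simp only [operands, List.length_append, List.length_singleton, List.length_flatMap, edgeSize]
  rfl

/-- A renaming fixing its variable fixes an operand. [folklore] -/
theorem Operand.rename_eq_self {h : σ → σ} {u : Operand k σ} (hu : ∀ i ∈ opVars u, h i = i) :
    u.rename h = u := by
  cases u with
  | var i => simp [Operand.rename, hu i (by simp [opVars])]
  | const c => rfl
  | gate j => rfl

/-- A renaming fixing its variables fixes a gate. [folklore] -/
theorem Gate.rename_eq_self {h : σ → σ} {g : Gate k σ}
    (hg : ∀ u ∈ g.args, ∀ i ∈ opVars u, h i = i) : g.rename h = g := by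
  cases g with
  | sum args =>
    simp only [Gate.rename]
    congr 1
    conv_rhs => rw [← List.map_id args]
    apply List.map_congr_left
    intro a ha
    exact Prod.ext rfl (Operand.rename_eq_self (hg a.2 (by
      simp only [Gate.args, List.mem_map]; exact ⟨a, ha, rfl⟩)))
  | prod args =>
    simp only [Gate.rename]
    congr 1
    conv_rhs => rw [← List.map_id args]
    apply List.map_congr_left
    intro u hu
    exact Operand.rename_eq_self (hg u hu)

/-- A renaming fixing every variable that occurs fixes the circuit.
[cite: Burgisser2000, Rem. 2.2] -/
theorem rename_eq_self {h : σ → σ} {P : ArithCircuit k σ} (hP : ∀ i ∈ circVars P, h i = i) :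
    P.rename h = P := by
  have hops : ∀ u ∈ P.operands, ∀ i ∈ opVars u, h i = i := fun u hu i hi =>
    hP i (List.mem_flatMap.2 ⟨u, hu, hi⟩)
  cases P with
  | mk gates output =>
    simp only [ArithCircuit.rename, ArithCircuit.mk.injEq]
    constructor
    · conv_rhs => rw [← List.map_id gates]
      apply List.map_congr_left
      intro g hg
      apply Gate.rename_eq_self
      intro u hu
      exact hops u (List.mem_append_left _ (List.mem_flatMap.2 ⟨g, hg, hu⟩))
    · exact Operand.rename_eq_self
        (hops output (List.mem_append_right _ (List.mem_singleton_self _)))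

end Rename

/-! ### The depth-three circuit of a polynomial, generic variable type -/

section Generic

open MvPolynomial ArithCircuit Literature.Computability.AlgebraicComplexity.DepthReduction

universe v

variable {k : Type} [Field k] [CharZero k] [IsAlgClosed k]
variable {σ : Type v} [Fintype σ] [DecidableEq σ] [Inhabited σ]

/-- Top fan-in bound of the depth-four step. [cite: Tavenas2015, Thm. 1; AgrawalVinay2008] -/
def tzero (s d t : ℕ) : ℕ :=
  (d + 1) * ((4 * s * (d + 1) ^ 2) * (4 * s * (d + 1) ^ 2)) ^ (8 * d / (t + 1))

/-- Product fan-in bound of the depth-four step. [cite: Tavenas2015, Thm. 1; AgrawalVinay2008] -/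
def wmax (d t : ℕ) : ℕ := 1 + 4 * (8 * d / (t + 1))

/-- The wire bound of the depth-three circuit, before the choice of `t`.
[cite: GuptaKamathKayalSaptharishi2016, §4, proof of Thm. 1.1] -/
def bound (N s d t : ℕ) : ℕ :=
  tzero s d t * (2 ^ wmax d t * ((mmax N t + 1) * wmax d t + 1)) *
    (mmax N t * (t * wmax d t) * (t + 2) + 1)

omit [CharZero k] [IsAlgClosed k] [Fintype σ] [DecidableEq σ] [Inhabited σ] in
/-- The top fan-in bound is monotone in the size. [folklore] -/
theorem tzero_mono {s s' d t : ℕ} (h : s ≤ s') : tzero s d t ≤ tzero s' d t := by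
  unfold tzero
  apply Nat.mul_le_mul_left
  apply Nat.pow_le_pow_left
  apply Nat.mul_le_mul <;> apply Nat.mul_le_mul_right <;> apply Nat.mul_le_mul_left _ h

/-- **GKKS Thm. 1.1 before bookkeeping** (generic variable type): a polynomial of degree `≤ d`
and complexity `≤ s` in `N` variables has, for every `t ≥ 1`, a `ΣΠΣ` circuit (product-depth
`≤ 1`) with at most `bound N s d t` wires.
[cite: GuptaKamathKayalSaptharishi2016, Thm. 1.1 and §4] -/
theorem exists_circuit_generic (f : MvPolynomial σ k) {s d t : ℕ} (hd : f.totalDegree ≤ d)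
    (hs : complexity f ≤ s) (ht : 1 ≤ t) :
    ∃ P : ArithCircuit k σ, P.Computes f ∧ P.productDepth ≤ 1 ∧
      P.edgeSize ≤ bound (Fintype.card σ) s d t := by
  obtain ⟨P₀, hfan, hcomp, hsize⟩ := ArithCircuit.exists_computes_size_eq_complexity f
  obtain ⟨S, hlen, hcases⟩ := exists_slp P₀ hfan
  rw [show P₀.eval = f from hcomp] at hcases
  rcases hcases with ⟨i, hi, hfi⟩ | ⟨j, hfj⟩ | ⟨c, hfc⟩
  · have hdi : (S.val i).totalDegree ≤ d := by rw [← hfi]; exact hd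
    obtain ⟨L, hsum, hLlen, hT⟩ := S.exists_sum_prod d ht hi hdi
    have hLlen' : L.length ≤ tzero s d t := by
      refine hLlen.trans ?_
      have : S.len ≤ s := by rw [hlen, hsize]; exact hs
      exact tzero_mono this
    have hsps := isSPS_of_lists (W := wmax d t) L hLlen' (fun τ hτ => hT τ hτ)
    rw [hsum, ← hfi] at hsps
    obtain ⟨P, hP, hpd, hE⟩ := hsps.exists_circuit
    exact ⟨P, hP, hpd, le_of_eq hE⟩
  · exact ⟨ArithCircuit.ofVar j, by rw [Computes, ArithCircuit.eval_ofVar, hfj],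
      by rw [productDepth_ofVar]; norm_num, Nat.zero_le _⟩
  · exact ⟨ArithCircuit.ofConst c, by rw [Computes, ArithCircuit.eval_ofConst, hfc],
      by rw [productDepth_ofConst]; norm_num, Nat.zero_le _⟩

end Generic

/-! ### Restriction to the variables that occur -/

section FinCase

open MvPolynomial ArithCircuit

/-- **GKKS Thm. 1.1 before bookkeeping**, over `Fin n`, with the number `N` of variables
actually used: `N ≤ n` and `N ≤ 2s + 2`. [cite: GuptaKamathKayalSaptharishi2016, Thm. 1.1 and §4] -/
theorem exists_circuit_fin {n s d t : ℕ} (f : MvPolynomial (Fin n) ℂ) (hd : f.totalDegree ≤ d)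
    (hs : complexity f ≤ s) (ht : 1 ≤ t) (hn : 1 ≤ n) :
    ∃ N, N ≤ n ∧ N ≤ 2 * s + 2 ∧ ∃ P : ArithCircuit ℂ (Fin n), P.Computes f ∧
      P.productDepth ≤ 1 ∧ P.edgeSize ≤ bound N s d t := by
  obtain ⟨P₀, hfan, hcomp, hsize⟩ := ArithCircuit.exists_computes_size_eq_complexity f
  set i₀ : Fin n := ⟨0, hn⟩ with hi₀
  set V : Finset (Fin n) := insert i₀ (circVars P₀).toFinset with hV
  have hi₀V : i₀ ∈ V := Finset.mem_insert_self _ _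
  haveI : Inhabited ↥V := ⟨⟨i₀, hi₀V⟩⟩
  let g : Fin n → ↥V := fun i => if h : i ∈ V then ⟨i, h⟩ else ⟨i₀, hi₀V⟩
  have hfix : ∀ i ∈ circVars P₀, (Subtype.val ∘ g) i = i := by
    intro i hi
    have hiV : i ∈ V := Finset.mem_insert_of_mem (List.mem_toFinset.2 hi)
    simp [g, hiV]
  have hPfix : P₀.rename (Subtype.val ∘ g) = P₀ := rename_eq_self hfix
  set f' : MvPolynomial ↥V ℂ := MvPolynomial.rename g f with hf'
  have hff' : MvPolynomial.rename Subtype.val f' = f := by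
    rw [hf', MvPolynomial.rename_rename]
    have := ArithCircuit.eval_rename_apply (Subtype.val ∘ g) P₀
    rw [hPfix] at this
    rw [show P₀.eval = f from hcomp] at this
    exact this.symm
  have hs' : complexity f' ≤ s :=
    (complexity_rename_le_of_exists g ⟨P₀, hfan, hcomp⟩).trans hs
  have hd' : f'.totalDegree ≤ d := (totalDegree_rename_le g f).trans hd
  obtain ⟨P', hP', hpd', hE'⟩ := exists_circuit_generic f' hd' hs' ht
  refine ⟨V.card, ?_, ?_, P'.rename Subtype.val, ?_, ?_, ?_⟩
  · exact (Finset.card_le_univ V).trans (by rw [Fintype.card_fin])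
  · have h1 : V.card ≤ (circVars P₀).toFinset.card + 1 := Finset.card_insert_le _ _
    have h2 : (circVars P₀).toFinset.card ≤ (circVars P₀).length := List.toFinset_card_le _
    have h3 := length_circVars_le P₀
    have h4 : P₀.edgeSize ≤ 2 * P₀.size := edgeSize_le_two_mul_size_holds hfan
    have h5 : P₀.size ≤ s := by rw [hsize]; exact hs
    omega
  · rw [← hff']; exact hP'.rename _
  · rw [productDepth_rename']; exact hpd'
  · rw [edgeSize_rename', ← Fintype.card_coe V]; exact hE'

end FinCase

/-! ### Bookkeeping: the choice of `t` and the final bound `2^{O(√(d log n log s log d))}` -/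

section Arithmetic

/-- Crude simplification of the wire bound.
[cite: GuptaKamathKayalSaptharishi2016, §4.3, Lemma 4.7 (size `O(s₂³a²bn)`)] -/
theorem bound_le (N s d t : ℕ) :
    bound N s d t ≤ tzero s d t * ((N + 1) ^ (2 * t) * 2 ^ (3 * wmax d t + 4 * t + 3)) := by
  unfold bound
  set M := mmax N t with hM
  set W := wmax d t with hW
  set T := tzero s d t with hT
  have hM1 : 1 ≤ M := by
    rw [hM, mmax]; exact Nat.mul_pos (Nat.pow_pos (Nat.succ_pos N)) (Nat.pow_pos two_pos)
  have hW2 : W + 1 ≤ 2 ^ W := Nat.lt_two_pow_self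
  have ht2 : t ≤ 2 ^ t := Nat.lt_two_pow_self.le
  have ht3 : t + 2 ≤ 2 ^ (t + 1) := Nat.lt_two_pow_self
  have h1 : (M + 1) * W + 1 ≤ M * 2 ^ (W + 1) := by
    calc (M + 1) * W + 1 ≤ (M + 1) * (W + 1) := by nlinarith
      _ ≤ (2 * M) * 2 ^ W := Nat.mul_le_mul (by omega) hW2
      _ = M * 2 ^ (W + 1) := by ring
  have h2 : M * (t * W) * (t + 2) + 1 ≤ M * 2 ^ (2 * t + W + 2) := by
    have hW3 : W ≤ 2 ^ W := Nat.lt_two_pow_self.le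
    calc M * (t * W) * (t + 2) + 1 ≤ M * (2 ^ t * 2 ^ W) * 2 ^ (t + 1) + M := by
          gcongr
      _ ≤ M * (2 ^ t * 2 ^ W) * 2 ^ (t + 1) + M * (2 ^ t * 2 ^ W) * 2 ^ (t + 1) := by
          apply Nat.add_le_add_left
          calc M = M * 1 * 1 := by ring
            _ ≤ M * (2 ^ t * 2 ^ W) * 2 ^ (t + 1) :=
              Nat.mul_le_mul (Nat.mul_le_mul_left _ (Nat.mul_pos (Nat.pow_pos two_pos)
                (Nat.pow_pos two_pos))) (Nat.pow_pos two_pos)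
      _ = M * 2 ^ (2 * t + W + 2) := by ring
  calc T * (2 ^ W * ((M + 1) * W + 1)) * (M * (t * W) * (t + 2) + 1)
      ≤ T * (2 ^ W * (M * 2 ^ (W + 1))) * (M * 2 ^ (2 * t + W + 2)) := by gcongr
    _ = T * ((M * M) * 2 ^ (3 * W + 2 * t + 3)) := by ring
    _ = T * ((N + 1) ^ (2 * t) * 2 ^ (3 * W + 4 * t + 3)) := by
        rw [hM, mmax]; ring

/-- The depth-four top fan-in in terms of `log s`, `log d`. [cite: Tavenas2015, Thm. 1] -/
theorem tzero_le {s d t Ls Ld : ℕ} (hs : s < 2 ^ Ls) (hd : d < 2 ^ Ld) (hLs : 1 ≤ Ls)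
    (hLd : 1 ≤ Ld) :
    tzero s d t ≤ 2 ^ (Ld + 10 * (8 * d / (t + 1) * (Ls * Ld))) := by
  unfold tzero
  set r := 8 * d / (t + 1) with hr
  have hd1 : d + 1 ≤ 2 ^ Ld := hd
  have hA : 4 * s * (d + 1) ^ 2 ≤ 2 ^ (2 + Ls + 2 * Ld) := by
    calc 4 * s * (d + 1) ^ 2 ≤ 4 * 2 ^ Ls * (2 ^ Ld) ^ 2 := by gcongr
      _ = 2 ^ (2 + Ls + 2 * Ld) := by ring
  have hAA : (4 * s * (d + 1) ^ 2) * (4 * s * (d + 1) ^ 2) ≤ 2 ^ (10 * (Ls * Ld)) := by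
    calc (4 * s * (d + 1) ^ 2) * (4 * s * (d + 1) ^ 2)
        ≤ 2 ^ (2 + Ls + 2 * Ld) * 2 ^ (2 + Ls + 2 * Ld) := Nat.mul_le_mul hA hA
      _ = 2 ^ (4 + 2 * Ls + 4 * Ld) := by ring
      _ ≤ 2 ^ (10 * (Ls * Ld)) := Nat.pow_le_pow_right two_pos (by nlinarith)
  calc (d + 1) * ((4 * s * (d + 1) ^ 2) * (4 * s * (d + 1) ^ 2)) ^ r
      ≤ 2 ^ Ld * (2 ^ (10 * (Ls * Ld))) ^ r := Nat.mul_le_mul hd1 (Nat.pow_le_pow_left hAA r)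
    _ = 2 ^ (Ld + 10 * (r * (Ls * Ld))) := by ring

end Arithmetic

/-! ### The discharge -/

open MvPolynomial ArithCircuit Literature.Computability.AlgebraicComplexity.DepthReduction in
/-- **GKKS 2016, Thm. 1.1 (first half)**, in the tree's rendering, with the universal constant
`K = 200` (independent of the exponent `a`: the hypothesis `d ≤ n^a + a` is not needed for the
bound with the `log d` factor). [cite: GuptaKamathKayalSaptharishi2016, Thm. 1.1] -/
theorem sigmaPiSigma_edgeSize_le (n s d : ℕ) (f : MvPolynomial (Fin n) ℂ) (hd : f.totalDegree ≤ d)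
    (hs : complexity f ≤ s) :
    ∃ P : ArithCircuit ℂ (Fin n), P.Computes f ∧ P.productDepth ≤ 1 ∧
      P.edgeSize ≤
        2 ^ (200 * Nat.sqrt (d * (Nat.log 2 n + 1) * (Nat.log 2 s + 1) * (Nat.log 2 d + 1)) +
          200) := by
  -- constants need no gate
  by_cases hf0 : f.totalDegree = 0
  · refine ⟨ArithCircuit.ofConst (f.coeff 0), ?_, by rw [productDepth_ofConst]; norm_num,
      Nat.zero_le _⟩
    rw [Computes, ArithCircuit.eval_ofConst]; exact (totalDegree_eq_zero_iff_eq_C.1 hf0).symm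
  have hd1 : 1 ≤ d := by omega
  have hn1 : 1 ≤ n := by
    rcases Nat.eq_zero_or_pos n with hn | hn
    · subst hn
      exfalso; apply hf0
      rw [MvPolynomial.eq_C_of_isEmpty f, totalDegree_C]
    · exact hn
  set Ls := Nat.log 2 s + 1 with hLs
  set Ld := Nat.log 2 d + 1 with hLd
  set Ln := Nat.log 2 n + 1 with hLn
  have hs2 : s < 2 ^ Ls := Nat.lt_pow_succ_log_self one_lt_two s
  have hd2 : d < 2 ^ Ld := Nat.lt_pow_succ_log_self one_lt_two d
  have hn2 : n < 2 ^ Ln := Nat.lt_pow_succ_log_self one_lt_two n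
  have hLs1 : 1 ≤ Ls := by omega
  have hLd1 : 1 ≤ Ld := by omega
  have hLn1 : 1 ≤ Ln := by omega
  set X := d * Ln * Ls * Ld with hX
  set R := Nat.sqrt X with hR
  have hXR : X < (R + 1) * (R + 1) := Nat.lt_succ_sqrt X
  have hLdd : Ld ≤ d := by
    have := Nat.log_lt_self 2 (show d ≠ 0 by omega)
    omega
  have hLdR : Ld ≤ R := by
    rw [hR, Nat.le_sqrt']
    calc Ld ^ 2 = Ld * Ld := by ring
      _ ≤ d * Ld := Nat.mul_le_mul_right _ hLdd
      _ ≤ d * Ld * (Ln * Ls) := Nat.le_mul_of_pos_right _ (Nat.mul_pos hLn1 hLs1)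
      _ = X := by rw [hX]; ring
  by_cases hreg : Ln ≤ R
  · -- regime `log n ≤ √(d log n log s log d)`: cut at `t = R / Ln`
    set t := R / Ln with ht
    have ht1 : 1 ≤ t := Nat.div_pos hreg hLn1
    have htLn : t * Ln ≤ R := Nat.div_mul_le_self R Ln
    have hRlt : R < (t + 1) * Ln := by
      have := Nat.lt_mul_div_succ R hLn1; rw [ht]; linarith [this]
    have htR : t ≤ R := (Nat.div_le_self R Ln)
    obtain ⟨N, hNn, -, P, hP, hpd, hE⟩ := exists_circuit_fin f hd hs ht1 hn1
    refine ⟨P, hP, hpd, hE.trans ((bound_le N s d t).trans ?_)⟩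
    set r := 8 * d / (t + 1) with hr
    have hr8 : r * (t + 1) ≤ 8 * d := Nat.div_mul_le_self _ _
    have hkey : r * (Ls * Ld) ≤ 8 * R + 7 := by
      have h1 : r * (Ls * Ld) * (R + 1) < 8 * (R + 1) * (R + 1) := by
        calc r * (Ls * Ld) * (R + 1) ≤ r * (Ls * Ld) * ((t + 1) * Ln) :=
              Nat.mul_le_mul_left _ hRlt
          _ = (r * (t + 1)) * (Ln * Ls * Ld) := by ring
          _ ≤ (8 * d) * (Ln * Ls * Ld) := Nat.mul_le_mul_right _ hr8
          _ = 8 * X := by rw [hX]; ring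
          _ < 8 * ((R + 1) * (R + 1)) := by linarith [hXR]
          _ = 8 * (R + 1) * (R + 1) := by ring
      have h2 := Nat.lt_of_mul_lt_mul_right h1
      omega
    have hrR : r ≤ 8 * R + 7 := by
      calc r = r * 1 := by ring
        _ ≤ r * (Ls * Ld) := Nat.mul_le_mul_left _ (Nat.mul_pos hLs1 hLd1)
        _ ≤ 8 * R + 7 := hkey
    have hN1 : N + 1 ≤ 2 ^ Ln := by omega
    have hNpow : (N + 1) ^ (2 * t) ≤ 2 ^ (2 * R) := by
      calc (N + 1) ^ (2 * t) ≤ (2 ^ Ln) ^ (2 * t) := Nat.pow_le_pow_left hN1 _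
        _ = 2 ^ (2 * (t * Ln)) := by ring
        _ ≤ 2 ^ (2 * R) := Nat.pow_le_pow_right two_pos (by omega)
    calc tzero s d t * ((N + 1) ^ (2 * t) * 2 ^ (3 * wmax d t + 4 * t + 3))
        ≤ 2 ^ (Ld + 10 * (r * (Ls * Ld))) * (2 ^ (2 * R) * 2 ^ (3 * wmax d t + 4 * t + 3)) :=
          Nat.mul_le_mul (tzero_le hs2 hd2 hLs1 hLd1) (Nat.mul_le_mul_right _ hNpow)
      _ = 2 ^ (Ld + 10 * (r * (Ls * Ld)) + 2 * R + (3 * wmax d t + 4 * t + 3)) := by ring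
      _ ≤ 2 ^ (200 * R + 200) := by
          apply Nat.pow_le_pow_right two_pos
          rw [wmax, ← hr]
          omega
  · -- regime `√(d log n log s log d) < log n`: cut at `t = 1`, few variables occur
    rw [not_le] at hreg
    obtain ⟨N, -, hNs, P, hP, hpd, hE⟩ := exists_circuit_fin f hd hs le_rfl hn1
    refine ⟨P, hP, hpd, hE.trans ((bound_le N s d 1).trans ?_)⟩
    have hkey : d * (Ls * Ld) ≤ R := by
      have h1 : d * (Ls * Ld) * (R + 1) < (R + 1) * (R + 1) := by
        calc d * (Ls * Ld) * (R + 1) ≤ d * (Ls * Ld) * Ln := Nat.mul_le_mul_left _ hreg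
          _ = X := by rw [hX]; ring
          _ < (R + 1) * (R + 1) := hXR
      have h2 := Nat.lt_of_mul_lt_mul_right h1
      omega
    have hr4 : 8 * d / (1 + 1) = 4 * d := by omega
    have hrLL : 8 * d / (1 + 1) * (Ls * Ld) ≤ 4 * R := by
      rw [hr4, mul_assoc]; exact Nat.mul_le_mul_left 4 hkey
    have hdR : d ≤ R := by
      calc d = d * 1 := by ring
        _ ≤ d * (Ls * Ld) := Nat.mul_le_mul_left _ (Nat.mul_pos hLs1 hLd1)
        _ ≤ R := hkey
    have hLsR : Ls ≤ R := by
      calc Ls = 1 * (Ls * 1) := by ring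
        _ ≤ d * (Ls * Ld) := Nat.mul_le_mul hd1 (Nat.mul_le_mul_left _ hLd1)
        _ ≤ R := hkey
    have hN1 : N + 1 ≤ 2 ^ (Ls + 2) := by
      have : 2 ^ (Ls + 2) = 4 * 2 ^ Ls := by ring
      omega
    have hNpow : (N + 1) ^ (2 * 1) ≤ 2 ^ (2 * Ls + 4) := by
      calc (N + 1) ^ (2 * 1) ≤ (2 ^ (Ls + 2)) ^ (2 * 1) := Nat.pow_le_pow_left hN1 _
        _ = 2 ^ (2 * Ls + 4) := by ring
    calc tzero s d 1 * ((N + 1) ^ (2 * 1) * 2 ^ (3 * wmax d 1 + 4 * 1 + 3))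
        ≤ 2 ^ (Ld + 10 * (8 * d / (1 + 1) * (Ls * Ld))) *
            (2 ^ (2 * Ls + 4) * 2 ^ (3 * wmax d 1 + 4 * 1 + 3)) :=
          Nat.mul_le_mul (tzero_le hs2 hd2 hLs1 hLd1) (Nat.mul_le_mul_right _ hNpow)
      _ = 2 ^ (Ld + 10 * (8 * d / (1 + 1) * (Ls * Ld)) + (2 * Ls + 4) +
            (3 * wmax d 1 + 4 * 1 + 3)) := by ring
      _ ≤ 2 ^ (200 * R + 200) := by
          apply Nat.pow_le_pow_right two_pos
          rw [wmax, hr4]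
          rw [hr4] at hrLL
          omega

end Literature.Computability.AlgebraicComplexity.DepthThreeChasm

/-- **Discharge** of the named fact
`Literature.Computability.AlgebraicComplexity.gkks_sigmaPiSigma_edgeSize_le_of_complexity`
(Gupta–Kamath–Kayal–Saptharishi 2016, Thm. 1.1, first half: an `n`-variate polynomial of degree
`d` computed by a circuit of size `s` has a `ΣΠΣ` circuit with `2^{O(√(d log n log s log d))}`
wires), with `K = 200` for every exponent `a`. Proof: depth-four reduction
(`DepthReduction.SLP.exists_sum_prod`, the tree's form of GKKS Step 1), Fischer's identity
(GKKS Lemma 4.3, Step 2), Saxena's duality trick and univariate splitting over `ℂ` (GKKS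
Lemmas 4.6–4.7, Step 3), counted in wires (GKKS §3).
[cite: GuptaKamathKayalSaptharishi2016, Thm. 1.1, Lemmas 4.3, 4.4, 4.6, 4.7] -/
theorem Literature.Computability.AlgebraicComplexity.gkks_sigmaPiSigma_edgeSize_le_of_complexity_holds :
    Literature.Computability.AlgebraicComplexity.gkks_sigmaPiSigma_edgeSize_le_of_complexity :=
  fun _ => ⟨200, fun n s d f hd _ hs =>
    Literature.Computability.AlgebraicComplexity.DepthThreeChasm.sigmaPiSigma_edgeSize_le n s d f hd hs⟩

end
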